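import Summits.ValiantsHypothesis.ValiantsHypothesis.Theorems.NewtonUnitEquationsTwoProductsRankOneAPLawPlanar
import HarnessLib

/-!
# Route NewtonUnitEquations — crux `TwoProducts` (stmt-ValiantsHypothesis-5906), line `relation_ladder`, rung R6c (three-term
# rank one, arithmetic-progression shape `2β = α + γ`): the VERONESE LIFT — part 4/5 — the upstairs weights, the slice identity, and per visible point a zero-avoiding strict pencil-minimiser (Parts V4 end, V5)

val-lit-p3 g15 (prover seat, helper mode `--supports stmt-ValiantsHypothesis-5906 --as helper`), 2026-08-28.  Rung R6c of val-idea-8's line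
`relation_ladder` (card `Lines/relation_ladder.md` v14 l.28–35; engine memo `Lines/relation_ladder_R6_engine.md` rev 3 §7′: «`2β = α + γ` (3-AP,
`ρ⁺ = {β,β}`): Veronese `X_α ↦ Z², X_β ↦ ZW, X_γ ↦ W²` after DOUBLING all planar exponents»).  THE THREE-TERM ARITHMETIC-PROGRESSION RANK-ONE
LAW: if ALL additive coincidences of the letter family `A_j = supp u_j ∪ supp v_j` come from ONE relation `α + γ = β + β` among DISTINCT
letters (`RankOneCoincidences A (2·e_β) (e_α + e_γ)`), then GLOBALLY `#visible ≤ 2^{c m} (#T + 2)^c` — the statement shape of R3♯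
`permTypeLaw_proof` / R6 `rankOneFourLaw_proof` / R6b `R6b.rankOneThreeLaw_proof`.  MECHANISM: the VERONESE LIFT realises the toric ring
`ℂ[Y]/(Y_β² − Y_αY_γ)` inside a FREE ring (variables `Z = Y_a`, `W = Y_c`, `Y_b` dead); the planar push-forward `Z ↦ α, W ↦ γ, Y_e ↦ 2e`
DOUBLES every planar exponent INSIDE the push-forward (`phi E' ∘ φ_ver = doubling ∘ phi enum`), so the instance `(u, v)` is never changed and
`ℕ²`-integrality is automatic; rank-one coincidences = injectivity on the lifted support (one level up from R3♯'s `injOn_of_permType`); Lemma A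
upstairs = the tree's `toric_minLog`; the fibre of the lift over a balanced exponent is `{#β = k : k ≡ x_Z (mod 2), k ≤ min(x_Z, x_W)}` with
CONSTANT letter count, and the multinomial regroups as `multinomial(x̂)·C(h,(x_W+k)/2)·C((x_W+k)/2,k)` in the HALF-DEGREE `h = (x_Z+x_W)/2` —
so with the reduced exponent `x̂ = (h @ Z, 0 @ Y_b, 0 @ W, rest)` every slice `b = x_W ≤ 2m` is a plain BINOMIAL-EXPONENTIAL sum of width
`≤ 2m(2m+1)²` (no parity bases, no square roots), counted by val-lit-p3 g14's tool `BinExpSum.binExpPencilCount` (p620797) through the landed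
`binExpPencilCount_fintype`; the slice identity `θ(x) = 2·Σ_i (−wt ξ ŝ_i) x̂_i + (Γ − A)·x_W` makes the slice functional affine along the pencil
of valid weights; degenerate case (a relation letter outside the alphabet) via R3♯.  All statements are by LITERAL body (no parameter-free
`def … : Prop`); generic toolkit (`phiT/piT`, `binChar/bsum/bwidth`, `toric_minLog`, `RankOneCoincidences`, `idxOf`, `rW`, `lwt_*`, `SIdx/tab/sgn`)
and the three-index API (`R6b.ThreeIdx`, `R6b.rest`, `R6b.prod_three_split`, …) are IMPORTED from the landed R6 / R6b ports, not re-declared.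
Honest scope: helper layer; nothing here closes the residual of the line, the crux `TwoProducts` (5906) or `VP ≠ VNP`; no summit statement is
proved. [folklore]
-/

noncomputable section

-- Sub = Summit single-conjunct layout: the duplicated namespace component is mandated by the tree.
set_option linter.dupNamespace false
set_option linter.unusedSimpArgs false

namespace Summit.ValiantsHypothesis.ValiantsHypothesis.Theorems.NewtonUnitEquations.TwoProducts.PermutationType
namespace R6c
open scoped BigOperators
open MvPolynomial

variable {σ : Type*} [Fintype σ] [DecidableEq σ]

variable (J : R6b.ThreeIdx σ)

/-! ### The upstairs weights -/

section VeronesePlanar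
open Summit.ValiantsHypothesis.ValiantsHypothesis.Theorems.NewtonUnitEquations.TwoProducts.FormalLogLinearisation
open Summit.ValiantsHypothesis.ValiantsHypothesis.Theorems.NewtonUnitEquations.TwoProducts.PlanarCell

variable {m : ℕ} {u v : Fin m → MvPolynomial (Fin 2) ℂ} (D : APData u v)



/-- **The upstairs weights** `θ`: `A` on `Z`, `Γ` on `W`, `2 r_i` elsewhere (`r_i = -wt ξ (enum i)` the letter weights;
the value at the dead variable `Y_b` is irrelevant). [folklore] -/
def APData.theta (ξ : Fin 2 → ℝ) (i : Fin (sE u v)) : ℝ :=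
  if i = D.idx.a then rW (u := u) (v := v) ξ D.idx.a else if i = D.idx.c then rW (u := u) (v := v) ξ D.idx.c
  else 2 * rW (u := u) (v := v) ξ i

omit [Fintype σ] [DecidableEq σ] in
/-- The upstairs weight at `Z`. [folklore] -/
theorem APData.theta_a (ξ : Fin 2 → ℝ) : D.theta ξ D.idx.a = rW ξ D.idx.a := by
  unfold APData.theta; rw [if_pos rfl]
omit [Fintype σ] [DecidableEq σ] in
/-- The upstairs weight at `W`. [folklore] -/
theorem APData.theta_c (ξ : Fin 2 → ℝ) : D.theta ξ D.idx.c = rW ξ D.idx.c := by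
  unfold APData.theta; rw [if_neg D.idx.hac.symm, if_pos rfl]
omit [Fintype σ] [DecidableEq σ] in
/-- The upstairs weight elsewhere. [folklore] -/
theorem APData.theta_other (ξ : Fin 2 → ℝ) (i : Fin (sE u v)) (ha : i ≠ D.idx.a) (hc : i ≠ D.idx.c) :
    D.theta ξ i = 2 * rW ξ i := by
  unfold APData.theta; rw [if_neg ha, if_neg hc]

omit [Fintype σ] [DecidableEq σ] in
/-- The relation on weights: `A + Γ = 2B`. [folklore] -/
theorem APData.rW_rel (ξ : Fin 2 → ℝ) : rW ξ D.idx.a + rW ξ D.idx.c = 2 * rW ξ D.idx.b := by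
  unfold rW
  rw [D.letters_idx.1, D.letters_idx.2.2, D.letters_idx.2.1, ← neg_add, ← wt_add, D.hrel, wt_add]; ring

omit [Fintype σ] [DecidableEq σ] in
/-- The upstairs weights are strictly positive for a valid `ξ`. [folklore] -/
theorem APData.theta_pos_of_valid (ξ : Fin 2 → ℝ) (i : Fin (sE u v)) (hval : ValidWeight u v ξ) : 0 < D.theta ξ i := by
  have hr : ∀ j, 0 < rW (u := u) (v := v) ξ j := fun j => by
    unfold rW; linarith [wt_enum_neg u v ξ hval j]
  unfold APData.theta
  split_ifs
  · exact hr _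
  · exact hr _
  · linarith [hr i]

omit [DecidableEq σ] in
/-- Linear weights of a doubled letter. [folklore] -/
theorem lwt_single_two (θ : σ → ℝ) (i : σ) : lwt θ (Finsupp.single i 2) = 2 * θ i := by
  rw [show (Finsupp.single i 2 : σ →₀ ℕ) = Finsupp.single i 1 + Finsupp.single i 1 by
    rw [← Finsupp.single_add], lwt_add, lwt_single]; ring

omit [Fintype σ] [DecidableEq σ] in
/-- The upstairs weight of a substituted letter is TWICE its planar weight. [folklore] -/
theorem APData.lwt_theta_verM (ξ : Fin 2 → ℝ) (i : Fin (sE u v)) : lwt (D.theta ξ) (verM D.idx i) = 2 * rW ξ i := by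
  have hrel := D.rW_rel ξ
  by_cases hia : i = D.idx.a
  · subst hia; rw [verM_a, lwt_single_two, D.theta_a]
  by_cases hib : i = D.idx.b
  · subst hib; rw [verM_b, lwt_add, lwt_single, lwt_single, D.theta_a, D.theta_c]; linarith
  by_cases hic : i = D.idx.c
  · subst hic; rw [verM_c, lwt_single_two, D.theta_c]
  rw [verM_other D.idx i hia hib hic, lwt_single, D.theta_other ξ i hia hic]

omit [Fintype σ] [DecidableEq σ] in
/-- On Veronese images the upstairs weight is the planar weight of the (doubled) push-forward. [folklore] -/
theorem APData.lwt_theta_piT (ξ : Fin 2 → ℝ) (L : Fin (sE u v) →₀ ℕ) :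
    lwt (D.theta ξ) (piT (verM D.idx) L) = -wt ξ (piE D.E' (piT (verM D.idx) L)) := by
  rw [lwt_piT, D.piE_E'_piT, wt_nsmul]
  have h : (fun i => lwt (D.theta ξ) (verM D.idx i)) = fun i => 2 * rW (u := u) (v := v) ξ i := by
    funext i; exact D.lwt_theta_verM ξ i
  rw [h]
  have h2 : lwt (fun i => 2 * rW (u := u) (v := v) ξ i) L = 2 * lwt (fun i => -wt ξ (enum u v i)) L := by
    unfold lwt rW; rw [Finset.mul_sum]; exact Finset.sum_congr rfl fun i _ => by ring
  rw [h2, lwt_eq_neg_wt]; push_cast; ring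

/-- The slice letters: `0` on `Y_b, W`, the letter itself elsewhere (so `α` on `Z`). [folklore] -/
def APData.swLetter (i : Fin (sE u v)) : Expo :=
  if i = D.idx.b ∨ i = D.idx.c then 0 else enum u v i

omit [Fintype σ] [DecidableEq σ] in
/-- **The slice identity for upstairs weights.** For balanced `x`:
`θ(x) = 2 Σ_i (-wt ξ (swLetter i)) · x̂_i + (Γ - A) · x_c`. [folklore] -/
theorem APData.lwt_theta_vbal (ξ : Fin 2 → ℝ) (x : Fin (sE u v) →₀ ℕ) (hx : VBal D.idx x) :
    lwt (D.theta ξ) x = 2 * (∑ i, -wt ξ (D.swLetter i) * ((vhat D.idx x i : ℕ) : ℝ)) +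
      (rW ξ D.idx.c - rW ξ D.idx.a) * ((x D.idx.c : ℕ) : ℝ) := by
  have F := And.intro D.idx.hab (And.intro D.idx.hac D.idx.hbc)
  have hx' : x D.idx.b = 0 ∧ (x D.idx.a + x D.idx.c) % 2 = 0 := hx
  have hh : 2 * ((x D.idx.a + x D.idx.c) / 2) = x D.idx.a + x D.idx.c := by omega
  have hhR : 2 * (((x D.idx.a + x D.idx.c) / 2 : ℕ) : ℝ) = (x D.idx.a : ℝ) + (x D.idx.c : ℝ) := by
    exact_mod_cast hh
  unfold lwt
  rw [R6b.sum_three_split D.idx, R6b.sum_three_split D.idx, vhat_a, vhat_b, vhat_c, hx'.1]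
  have hrest : ∑ j ∈ R6b.rest D.idx, D.theta ξ j * ((x j : ℕ) : ℝ) =
      2 * ∑ j ∈ R6b.rest D.idx, -wt ξ (D.swLetter j) * ((vhat D.idx x j : ℕ) : ℝ) := by
    rw [Finset.mul_sum]
    refine Finset.sum_congr rfl fun j hj => ?_
    rw [R6b.mem_rest] at hj
    rw [vhat_other D.idx x j hj.1 hj.2.1 hj.2.2, D.theta_other ξ j hj.1 hj.2.2]
    unfold APData.swLetter rW
    rw [if_neg (not_or.mpr ⟨hj.2.1, hj.2.2⟩)]
    ring
  have hsa : D.swLetter D.idx.a = enum u v D.idx.a := by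
    unfold APData.swLetter; rw [if_neg (not_or.mpr ⟨F.1, F.2.1⟩)]
  have hsb : D.swLetter D.idx.b = 0 := by
    unfold APData.swLetter; rw [if_pos (Or.inl rfl)]
  have hsc : D.swLetter D.idx.c = 0 := by
    unfold APData.swLetter; rw [if_pos (Or.inr rfl)]
  rw [hrest, hsa, hsb, hsc, FormalLogLinearisation.wt_zero, D.theta_a, D.theta_c]
  have hα : -wt ξ (enum u v D.idx.a) = rW ξ D.idx.a := rfl
  rw [hα]
  push_cast
  have : rW (u := u) (v := v) ξ D.idx.a * (((x D.idx.a + x D.idx.c) / 2 : ℕ) : ℝ) * 2 =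
      rW ξ D.idx.a * ((x D.idx.a : ℝ) + (x D.idx.c : ℝ)) := by rw [mul_assoc, mul_comm _ (2 : ℝ), hhR]
  linarith [this]

end VeronesePlanar



/-! ## Part V5: the slicing — per visible point; the count; the arithmetic; the law -/

section VeroneseCount
open Summit.ValiantsHypothesis.ValiantsHypothesis.Theorems.NewtonUnitEquations.TwoProducts.FormalLogLinearisation
open Summit.ValiantsHypothesis.ValiantsHypothesis.Theorems.NewtonUnitEquations.TwoProducts.PlanarCell

variable {m : ℕ} {u v : Fin m → MvPolynomial (Fin 2) ℂ} (D : APData u v)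

omit [Fintype σ] [DecidableEq σ] in
/-- **Per visible point.** A visible point `l` (valid `ξ`) yields a balanced Veronese point `x₀` over `2l` with slice
coordinate `b = x₀(W) ≤ 2m`, whose reduced exponent `x̂₀` is a zero-avoiding STRICT minimiser of the slice functional
`ν ↦ Σ_i (-wt ξ (swLetter i)) ν_i` on `{ν : F_b(ν) ≠ 0}` over ALL of `ℕ^s`. [folklore] -/
theorem APData.sliceMin_of_visible (hu : ∀ j, coeff 0 (u j) = 0) (hv : ∀ j, coeff 0 (v j) = 0)
    (hinj : Set.InjOn (piE D.E') ↑D.GT.support) (ξ : Fin 2 → ℝ) (hval : ValidWeight u v ξ) (l : Expo)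
    (htop : IsStrictTop ξ ↑(tailDiff u v).support l) :
    ∃ x₀ : Fin (sE u v) →₀ ℕ, piE D.E' x₀ = 2 • l ∧ VBal D.idx x₀ ∧ x₀ D.idx.c ≤ 2 * m ∧
      VFsl D.idx (cU u v) (cV u v) (x₀ D.idx.c) (vhat D.idx x₀) ≠ 0 ∧
      ∀ ν : Fin (sE u v) → ℕ, ν ≠ ⇑(vhat D.idx x₀) → VFsl D.idx (cU u v) (cV u v) (x₀ D.idx.c) ν ≠ 0 →
        ∑ i, -wt ξ (D.swLetter i) * ((vhat D.idx x₀ i : ℕ) : ℝ) < ∑ i, -wt ξ (D.swLetter i) * (ν i : ℝ) := by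
  classical
  have _hu := hu; have _hv := hv
  obtain ⟨x₀, hx₀, hπ, hmin⟩ := D.lifted_of_visible hinj ξ l htop
  obtain ⟨L₀, hL₀, hx₀L⟩ := D.exists_of_mem_support_GT x₀ hx₀
  have hbal : VBal D.idx x₀ := hx₀L ▸ vbal_piT D.idx L₀
  have hdegL : deg L₀ ≤ m := deg_le_of_mem_support_liftG _ _ L₀ hL₀
  have hc_le : x₀ D.idx.c ≤ 2 * m := by
    rw [← hx₀L, piT_verM_c]
    have h := deg_eq_sum L₀
    rw [R6b.sum_three_split D.idx] at h
    omega
  -- the upstairs weights and their normalisation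
  set θ : Fin (sE u v) → ℝ := D.theta ξ with hθdef
  have hθpos : ∀ i, 0 < θ i := fun i => D.theta_pos_of_valid ξ i hval
  have hne : (Finset.univ : Finset (Fin (sE u v))).Nonempty := ⟨D.idx.a, Finset.mem_univ _⟩
  set θmin : ℝ := Finset.univ.inf' hne θ with hθmin
  have hθmin_pos : 0 < θmin := by
    obtain ⟨i, -, hi⟩ := Finset.exists_mem_eq_inf' hne θ
    rw [hθmin, hi]; exact hθpos i
  have hθmin_le : ∀ i, θmin ≤ θ i := fun i => Finset.inf'_le θ (Finset.mem_univ i)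
  set θ' : Fin (sE u v) → ℝ := fun i => θ i / θmin with hθ'
  have hθ'1 : ∀ i, 1 ≤ θ' i := fun i => by
    rw [hθ']; simp only; rw [le_div_iff₀ hθmin_pos, one_mul]; exact hθmin_le i
  have hlwt' : ∀ x : Fin (sE u v) →₀ ℕ, lwt θ' x = lwt θ x / θmin := fun x => by
    unfold lwt; rw [Finset.sum_div]
    refine Finset.sum_congr rfl fun i _ => ?_
    rw [hθ']; ring
  have hlwtG : ∀ x ∈ D.GT.support, lwt θ x = -wt ξ (piE D.E' x) := fun x hx => by
    obtain ⟨L, -, rfl⟩ := D.exists_of_mem_support_GT x hx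
    exact D.lwt_theta_piT ξ L
  have hminθ' : x₀ ∈ (phiT (verM D.idx) (liftG (cU u v) (cV u v))).support ∧
      ∀ x ∈ (phiT (verM D.idx) (liftG (cU u v) (cV u v))).support, x ≠ x₀ → lwt θ' x₀ < lwt θ' x := by
    refine ⟨hx₀, fun x hx hne' => ?_⟩
    rw [hlwt', hlwt']
    apply div_lt_div_of_pos_right _ hθmin_pos
    rw [hlwtG x₀ hx₀, hlwtG x hx, hπ]
    linarith [hmin x hx hne']
  have hA := toric_minLog (verM D.idx) (verM_ne_zero D.idx) θ' hθ'1 (cU u v) (cV u v) x₀ hminθ'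
  set R : ℕ := ⌊lwt θ' x₀⌋₊ + 1 with hRdef
  have hRlt : lwt θ' x₀ < R := by rw [hRdef]; push_cast; exact Nat.lt_floor_add_one _
  -- degrees of `x₀`
  have hx₀ne : x₀ ≠ 0 := by
    intro h0
    have := mem_support_iff.mp hx₀
    apply this
    rw [h0]
    unfold APData.GT
    rw [phiT_liftG, coeff_sub,
      coeff_zero_prod_eq_one _ (fun j => coeff_zero_one_add_phiT_lin (verM D.idx) (verM_ne_zero D.idx) _),
      coeff_zero_prod_eq_one _ (fun j => coeff_zero_one_add_phiT_lin (verM D.idx) (verM_ne_zero D.idx) _), sub_self]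
  have hbal' : x₀ D.idx.b = 0 ∧ (x₀ D.idx.a + x₀ D.idx.c) % 2 = 0 := hbal
  have hdeg1 : 1 ≤ deg (vhat D.idx x₀) := by
    by_contra h0
    push Not at h0
    apply hx₀ne
    apply (deg_eq_zero_iff x₀).mp
    have h1 := deg_eq_deg_vhat_add D.idx x₀ hbal
    have h2 := deg_vhat D.idx x₀
    omega
  have hdegR : deg (vhat D.idx x₀) ≤ R := by
    have h1 := deg_eq_deg_vhat_add D.idx x₀ hbal
    have h2 : (deg x₀ : ℝ) ≤ lwt θ' x₀ := deg_le_lwt θ' hθ'1 x₀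
    have h3 : (deg x₀ : ℝ) < R := lt_of_le_of_lt h2 hRlt
    have h4 : deg x₀ < R := by exact_mod_cast h3
    omega
  have hF0 : VFsl D.idx (cU u v) (cV u v) (x₀ D.idx.c) (vhat D.idx x₀) ≠ 0 :=
    (mem_support_veronese_logTrunc_iff D.idx (cU u v) (cV u v) R x₀ hbal hdeg1 hdegR).mp hA.1
  refine ⟨x₀, hπ, hbal, hc_le, hF0, fun ν hν hFν => ?_⟩
  obtain ⟨hνb, hνc, hbν⟩ := shape_of_VFsl_ne_zero D.idx (cU u v) (cV u v) _ ν hFν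
  set x' : Fin (sE u v) →₀ ℕ := vxOf D.idx (x₀ D.idx.c) ν with hx'def
  have hbalx' : VBal D.idx x' := vxOf_vbal D.idx _ ν hbν
  have hxh' : ⇑(vhat D.idx x') = ν := vhat_vxOf D.idx _ ν hbν hνb hνc
  have hx'c : x' D.idx.c = x₀ D.idx.c := vxOf_c D.idx _ ν
  have hne' : x' ≠ x₀ := by
    intro h; apply hν; rw [← hxh', h]
  have hdeg1' : 1 ≤ deg (vhat D.idx x') := by
    by_contra h0
    push Not at h0
    have hz : vhat D.idx x' = 0 := (deg_eq_zero_iff _).mp (by omega)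
    have hνz : ∀ j, ν j = 0 := fun j => by rw [← hxh', hz]; rfl
    have hb0 : x₀ D.idx.c = 0 := by have := hνz D.idx.a; omega
    apply hFν
    rw [hb0]; exact VFsl_zero_zero D.idx (cU u v) (cV u v) ν hνz
  have hlt' : lwt θ' x₀ < lwt θ' x' := by
    by_cases hR' : deg (vhat D.idx x') ≤ R
    · have hmem : x' ∈ (phiT (verM D.idx) (logTrunc (cU u v) (cV u v) R)).support :=
        (mem_support_veronese_logTrunc_iff D.idx (cU u v) (cV u v) R x' hbalx' hdeg1' hR').mpr
          (by rw [hx'c, hxh']; exact hFν)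
      exact hA.2 x' hmem hne'
    · push Not at hR'
      have h1 := deg_eq_deg_vhat_add D.idx x' hbalx'
      have h2 : (deg x' : ℝ) ≤ lwt θ' x' := deg_le_lwt θ' hθ'1 x'
      have h3 : (R : ℝ) < deg (vhat D.idx x') := by exact_mod_cast hR'
      have h4 : (deg (vhat D.idx x') : ℝ) ≤ deg x' := by exact_mod_cast (by omega : deg (vhat D.idx x') ≤ deg x')
      linarith
  have hlt : lwt θ x₀ < lwt θ x' := by
    have := hlt'
    rw [hlwt', hlwt'] at this
    exact (div_lt_div_iff_of_pos_right hθmin_pos).mp this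
  rw [hθdef, D.lwt_theta_vbal ξ x₀ hbal, D.lwt_theta_vbal ξ x' hbalx', hx'c] at hlt
  rw [hxh'] at hlt
  linarith


end VeroneseCount

end R6c
end Summit.ValiantsHypothesis.ValiantsHypothesis.Theorems.NewtonUnitEquations.TwoProducts.PermutationType

end
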